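import Literature.Probability.LatticeModels.LatticeGreenPoisson
import Literature.Probability.LatticeModels.DirichletGreenLimit
import Literature.Probability.LatticeModels.LatticeDirichletEnergy
import Literature.Probability.LatticeModels.DirichletLatticeGFF
import Literature.LinearAlgebra.Matrix.InverseMMatrixProofs

/-!
# The lattice Green kernel of `ℤ^d` (`d ≥ 3`) is a symmetric potential with finite-range precision

Topic `Literature/Probability/LatticeModels`; companion of `LatticeGreenPoisson.lean` (`(-Δ)(latticeGreen/2) = δ₀`),
`DirichletGreenFunction.lean` / `DirichletLatticeGFF.lean` (the Dirichlet Laplacian matrix `dirichletMatrix Λ = -Δ_Λ`,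
invertible and positive definite, its Green function `dirichletGreen`), `DirichletGreenLimit.lean`
(`G_{[-n,n]^d}(x,y) → G₀(x - y)`, `G₀ = latticeGreen/2`), `LatticeDirichletEnergy.lean` (`∑_S f² ≤ 2d · greenEnergy S f`)
and `LinearAlgebra/Matrix/InverseMMatrix.lean` (potential matrices, DMS Lemma 2.32).  Everything here is PROVED; no
named fact is introduced.  For a finite `A ⊆ ℤ^d` write `G₀|_A := (latticeGreen (q - p) / 2)_{p,q ∈ A}` (inlined as
`Matrix.of fun p q : A => latticeGreen (q.1 - p.1) / 2`).

* `latticeGreen_neg` — `latticeGreen` is even.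
* `dotProduct_halfGreen_mulVec`, **`posDef_halfGreen`** (`d ≥ 3`) — the quadratic form of `G₀|_A` is half the free
  Coulomb energy, so `G₀|_A` is positive definite (Bochner; here from `sum_sq_le_mul_greenEnergy`).
* **`isPotentialMatrix_inv_dirichletMatrix`** (`d ≥ 1`) — `(-Δ_Λ)⁻¹` is a potential matrix in the sense of
  Dellacherie–Martínez–San Martín: entrywise `≥ 0`, nonsingular, inverse a Z-matrix with nonnegative row sums
  ("the potential of a transient (killed) Markov chain is a potential matrix", DMS 2014 §2.1–2.2; Lawler 1991 §1.5).
* `isPotentialMatrix_dirichletGreen_restrict` — hence so is every restriction `(G_Λ(p,q))_{p,q ∈ A}`, `A ⊆ Λ`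
  (DMS Lemma 2.32, tree `principalSubmatrix_closure_holds`).
* `tendsto_dirichletGreen_restrict_box`, `tendsto_inv_dirichletGreen_restrict_box`, **`isPotentialMatrix_halfGreen`**
  (`d ≥ 3`) — passing to the limit `Λ = [-n,n]^d ↑ ℤ^d`: **every finite restriction `G₀|_A` of the Green kernel of `ℤ^d`
  is a symmetric potential matrix** (positive definite, `(G₀|_A)⁻¹` a Z-matrix with nonnegative row sums) — the
  infinite-volume Gaussian-free-field instance of the inverse-M-matrix / MTP₂ structure.
* **`inv_halfGreen_origin_row`** (`d ≥ 3`) — finite-range precision (domain Markov property at the level of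
  `Matrix.inv`): if `A` contains `0` and its `2d` neighbours then row `0` of `(G₀|_A)⁻¹` is row `0` of `-Δ_A`
  (`2d` at `0`, `-1` at `±eᵢ`, `0` elsewhere), by `(-Δ) G₀ = δ₀`.

## References
* G. F. Lawler, *Intersections of Random Walks* (1991), §1.5 (Green function, `ΔG = -δ`, killed walk) [Lawler1991].
* C. Dellacherie, S. Martínez, J. San Martín, *Inverse M-Matrices and Ultrametric Matrices*, LNM 2118 (2014), ch. 2,
  §2.1–2.2 and Lemma 2.32 [DellacherieMartinezSanmartin2014].
-/

noncomputable section

namespace Literature.Probability.LatticeModels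

open Literature.LinearAlgebra.Matrix (IsZMatrix IsInverseMMatrix IsPotentialMatrix principalSubmatrix_closure_holds)
open Finset Filter _root_.Topology
open scoped _root_.Matrix

variable {d : ℕ}

/-! ### Evenness and the quadratic form -/

/-- `latticeGreen (-z) = latticeGreen z`: the Green integrand `cos (p·z)/ε(p)` is even in `z`. [folklore] -/
theorem latticeGreen_neg (z : Site d) : latticeGreen (-z) = latticeGreen z := by
  simp only [latticeGreen, Pi.neg_apply, Int.cast_neg, mul_neg, Finset.sum_neg_distrib, Real.cos_neg]

/-- `latticeGreen (a - b) = latticeGreen (b - a)`. [folklore] -/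
theorem latticeGreen_sub_comm (a b : Site d) : latticeGreen (a - b) = latticeGreen (b - a) := by
  rw [← latticeGreen_neg, neg_sub]

/-- The quadratic form of `G₀|_A` is half the free Coulomb energy of the zero-extended charge:
`cᵀ (G₀|_A) c = ½ greenEnergy A c̄`. [folklore] -/
theorem dotProduct_halfGreen_mulVec (A : Finset (Site d)) (c : A → ℝ) :
    c ⬝ᵥ ((Matrix.of fun p q : A => latticeGreen (q.1 - p.1) / 2) *ᵥ c) =
      (1 / 2) * greenEnergy A (zeroExtend A c) := by
  simp only [dotProduct, Matrix.mulVec, Matrix.of_apply, greenEnergy, Finset.mul_sum]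
  rw [← Finset.sum_coe_sort A]
  refine Finset.sum_congr rfl fun p _ => ?_
  rw [← Finset.sum_coe_sort A]
  refine Finset.sum_congr rfl fun q _ => ?_
  rw [latticeGreen_sub_comm q.1 p.1]
  simp only [zeroExtend_coe]
  ring

variable (d) in
/-- **`G₀|_A` is positive definite** (`d ≥ 3`): `cᵀ (G₀|_A) c = ½ greenEnergy A c̄ ≥ ∑_A c̄²/(4d) > 0` for `c ≠ 0`
(`sum_sq_le_mul_greenEnergy`; Bochner positivity of `1/ε`). [folklore] -/
theorem posDef_halfGreen (hd : 3 ≤ d) (A : Finset (Site d)) :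
    (Matrix.of fun p q : A => latticeGreen (q.1 - p.1) / 2).PosDef := by
  rw [Matrix.posDef_iff_dotProduct_mulVec]
  refine ⟨Matrix.IsHermitian.ext fun p q => ?_, fun c hc => ?_⟩
  · simp only [star_trivial, Matrix.of_apply]
    rw [latticeGreen_sub_comm]
  · rw [star_trivial, dotProduct_halfGreen_mulVec]
    obtain ⟨p, hp⟩ := Function.ne_iff.mp hc
    have hp' : c p ≠ 0 := hp
    have hsq : 0 < ∑ x ∈ A, zeroExtend A c x ^ 2 := by
      have h1 : zeroExtend A c p ^ 2 ≤ ∑ x ∈ A, zeroExtend A c x ^ 2 :=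
        Finset.single_le_sum (f := fun x => zeroExtend A c x ^ 2) (fun x _ => sq_nonneg _) p.2
      have h2 : 0 < zeroExtend A c p ^ 2 := by
        rw [zeroExtend_coe]; positivity
      linarith
    have hE := sum_sq_le_mul_greenEnergy (d := d) hd A (zeroExtend A c)
    have hd0 : (0 : ℝ) < 2 * d := by
      have : (3 : ℝ) ≤ d := by exact_mod_cast hd
      linarith
    have hpos : 0 < greenEnergy A (zeroExtend A c) := by
      by_contra hneg
      push Not at hneg
      have : 2 * (d : ℝ) * greenEnergy A (zeroExtend A c) ≤ 0 :=
        mul_nonpos_of_nonneg_of_nonpos hd0.le hneg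
      linarith
    linarith

/-! ### The Dirichlet Green matrices are potential matrices -/

variable (d) in
/-- **`(-Δ_Λ)⁻¹` is a potential matrix** (`d ≥ 1`): its entries `G_Λ(x,y)` are `≥ 0`, it is nonsingular, and its
inverse `-Δ_Λ` is a Z-matrix (off-diagonal entries `-1` or `0`) with row sums `#{y ∼ x : y ∉ Λ} ≥ 0` — "the potential of
a transient (sub-Markovian) chain is a potential matrix".
[cite: DellacherieMartinezSanmartin2014, Ch. 2, §2.1] -/
theorem isPotentialMatrix_inv_dirichletMatrix (hd : 0 < d) (Λ : Finset (Site d)) :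
    IsPotentialMatrix (dirichletMatrix Λ)⁻¹ := by
  have hdet : IsUnit (dirichletMatrix Λ).det := isUnit_det_dirichletMatrix hd Λ
  have hinv : (dirichletMatrix Λ)⁻¹⁻¹ = dirichletMatrix Λ := Matrix.nonsing_inv_nonsing_inv _ hdet
  refine ⟨⟨fun i j => ?_, Matrix.isUnit_nonsing_inv_det _ hdet, fun i j hij => ?_⟩, fun i => ?_⟩
  · rw [← dirichletGreen_of_mem i.2 j.2]
    exact dirichletGreen_nonneg hd Λ i j
  · rw [hinv]
    simp only [dirichletMatrix, hij, if_false]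
    split_ifs <;> norm_num
  · rw [hinv]
    have h := mulVec_dirichletMatrix Λ (fun _ => (1 : ℝ)) i
    simp only [Matrix.mulVec, dotProduct, mul_one] at h
    rw [h, latticeLaplacianZd_eq_sum_neighborFinset, neg_nonneg]
    refine Finset.sum_nonpos fun y _ => ?_
    have h1 : zeroExtend Λ (fun _ : Λ => (1 : ℝ)) (i : Site d) = 1 := zeroExtend_coe _ i
    have h2 : zeroExtend Λ (fun _ : Λ => (1 : ℝ)) y ≤ 1 := by
      by_cases hy : y ∈ Λ
      · rw [zeroExtend_of_mem _ hy]
      · rw [zeroExtend_of_not_mem _ hy]; exact zero_le_one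
    linarith

variable (d) in
/-- **Restrictions of the Dirichlet Green function are potential matrices** (`d ≥ 1`): for `A ⊆ Λ`, the matrix
`(G_Λ(p,q))_{p,q ∈ A}` is a principal submatrix of the potential matrix `(-Δ_Λ)⁻¹`, hence a potential matrix — its
inverse is a Z-matrix with nonnegative row sums (DMS Lemma 2.32, the Schur-complement closure).
[cite: DellacherieMartinezSanmartin2014, Lemma 2.32] -/
theorem isPotentialMatrix_dirichletGreen_restrict (hd : 0 < d) {A Λ : Finset (Site d)} (hA : A ⊆ Λ) :
    IsPotentialMatrix (Matrix.of fun p q : A => dirichletGreen Λ p.1 q.1) := by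
  let f : A ↪ Λ := ⟨fun a => ⟨a.1, hA a.2⟩, fun a b h => Subtype.ext (by simpa using congrArg Subtype.val h)⟩
  have hsub : ((dirichletMatrix Λ)⁻¹).submatrix f f = Matrix.of fun p q : A => dirichletGreen Λ p.1 q.1 := by
    ext p q
    simp only [Matrix.submatrix_apply, Matrix.of_apply]
    exact (dirichletGreen_of_mem (hA p.2) (hA q.2)).symm
  rw [← hsub]
  exact ((principalSubmatrix_closure_holds _ _ (dirichletMatrix Λ)⁻¹ f).2.1
    (isPotentialMatrix_inv_dirichletMatrix d hd Λ)).1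

/-! ### The limit `Λ ↑ ℤ^d`: `G₀|_A` is a symmetric potential matrix -/

variable (d) in
/-- `(G_{[-n,n]^d}(p,q))_{p,q ∈ A} → G₀|_A` entrywise, `G₀ = latticeGreen/2` (`d ≥ 3`; `tendsto_dirichletGreen_box`).
[cite: Lawler1991, §1.5] -/
theorem tendsto_dirichletGreen_restrict_box (hd : 3 ≤ d) (A : Finset (Site d)) :
    Tendsto (fun n : ℕ => Matrix.of fun p q : A => dirichletGreen (box d n) p.1 q.1) atTop
      (𝓝 (Matrix.of fun p q : A => latticeGreen (q.1 - p.1) / 2)) := by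
  refine tendsto_pi_nhds.2 fun p => tendsto_pi_nhds.2 fun q => ?_
  have h := tendsto_dirichletGreen_box d hd p.1 q.1
  simp only [Matrix.of_apply]
  rw [latticeGreen_sub_comm q.1 p.1]
  exact h

variable (d) in
/-- The inverses converge as well, `G₀|_A` being invertible (`d ≥ 3`). [folklore] -/
theorem tendsto_inv_dirichletGreen_restrict_box (hd : 3 ≤ d) (A : Finset (Site d)) :
    Tendsto (fun n : ℕ => (Matrix.of fun p q : A => dirichletGreen (box d n) p.1 q.1)⁻¹) atTop
      (𝓝 (Matrix.of fun p q : A => latticeGreen (q.1 - p.1) / 2)⁻¹) := by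
  have hV : IsUnit (Matrix.of fun p q : A => latticeGreen (q.1 - p.1) / 2).det :=
    (Matrix.isUnit_iff_isUnit_det _).1 (posDef_halfGreen d hd A).isUnit
  have hc : ContinuousAt Ring.inverse (Matrix.of fun p q : A => latticeGreen (q.1 - p.1) / 2).det := by
    obtain ⟨u, hu⟩ := hV
    rw [← hu]
    exact NormedRing.inverse_continuousAt u
  exact (continuousAt_matrix_inv _ hc).tendsto.comp (tendsto_dirichletGreen_restrict_box d hd A)

/-- A finite set lies in the boxes `[-n,n]^d` eventually (a proof of the shape of the named fact
`eventually_subset_box` of `ThermodynamicLimit`, kept local to avoid the import). [folklore] -/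
theorem finset_eventually_subset_box (A : Finset (Site d)) : ∀ᶠ n : ℕ in atTop, A ⊆ box d n := by
  have h := (Filter.eventually_all_finset A (l := atTop) (p := fun x n => x ∈ box d n)).2
    fun x _ => eventually_mem_box x
  exact h.mono fun n hn x hx => hn x hx

variable (d) in
/-- **Every finite restriction of the Green kernel of `ℤ^d` is a symmetric potential matrix** (`d ≥ 3`):
`G₀|_A = (latticeGreen (q - p)/2)_{p,q ∈ A}` is positive definite, entrywise `≥ 0`, and `(G₀|_A)⁻¹` is a Z-matrix
with nonnegative row sums.  (The Green kernel of the transient simple random walk / covariance of the massless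
Gaussian free field of `ℤ^d` is a potential in the sense of DMS ch. 2: the finite-volume statement
`isPotentialMatrix_dirichletGreen_restrict` passes to the limit `Λ = [-n,n]^d ↑ ℤ^d`, inversion being continuous at
the positive definite limit.) [cite: DellacherieMartinezSanmartin2014, Ch. 2, §2.1–2.2 and Lemma 2.32] -/
theorem isPotentialMatrix_halfGreen (hd : 3 ≤ d) (A : Finset (Site d)) :
    IsPotentialMatrix (Matrix.of fun p q : A => latticeGreen (q.1 - p.1) / 2) := by
  have hd0 : 0 < d := by omega
  set V : Matrix A A ℝ := Matrix.of fun p q : A => latticeGreen (q.1 - p.1) / 2 with hV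
  have hT := tendsto_inv_dirichletGreen_restrict_box d hd A
  have hdet : IsUnit V.det := (Matrix.isUnit_iff_isUnit_det _).1 (posDef_halfGreen d hd A).isUnit
  refine ⟨⟨fun i j => ?_, hdet, fun u v huv => ?_⟩, fun u => ?_⟩
  · simp only [hV, Matrix.of_apply]
    exact div_nonneg (latticeGreen_nonneg d hd _) zero_le_two
  · have hlim : Tendsto (fun n : ℕ => (Matrix.of fun p q : A => dirichletGreen (box d n) p.1 q.1)⁻¹ u v) atTop
        (𝓝 (V⁻¹ u v)) :=
      tendsto_pi_nhds.1 (tendsto_pi_nhds.1 hT u) v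
    refine le_of_tendsto hlim ?_
    filter_upwards [finset_eventually_subset_box A] with n hn
    exact (isPotentialMatrix_dirichletGreen_restrict d hd0 hn).1.2.2 u v huv
  · have hlim : Tendsto (fun n : ℕ => ∑ w, (Matrix.of fun p q : A => dirichletGreen (box d n) p.1 q.1)⁻¹ u w) atTop
        (𝓝 (∑ w, V⁻¹ u w)) :=
      tendsto_finsetSum _ fun w _ => tendsto_pi_nhds.1 (tendsto_pi_nhds.1 hT u) w
    refine ge_of_tendsto hlim ?_
    filter_upwards [finset_eventually_subset_box A] with n hn
    exact (isPotentialMatrix_dirichletGreen_restrict d hd0 hn).2 u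

variable (d) in
/-- The conclusion of `isPotentialMatrix_halfGreen` unbundled: `G₀|_A` is positive definite and `(G₀|_A)⁻¹` has
nonpositive off-diagonal entries and nonnegative row sums (`d ≥ 3`).
[cite: DellacherieMartinezSanmartin2014, Ch. 2, §2.1–2.2 and Lemma 2.32] -/
theorem halfGreen_symmPotential (hd : 3 ≤ d) (A : Finset (Site d)) :
    (Matrix.of fun p q : A => latticeGreen (q.1 - p.1) / 2).PosDef ∧
      ∀ u v : A, (u ≠ v → (Matrix.of fun p q : A => latticeGreen (q.1 - p.1) / 2)⁻¹ u v ≤ 0) ∧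
        0 ≤ ∑ w, (Matrix.of fun p q : A => latticeGreen (q.1 - p.1) / 2)⁻¹ u w := by
  have h := isPotentialMatrix_halfGreen d hd A
  exact ⟨posDef_halfGreen d hd A, fun u v => ⟨fun huv => h.1.2.2 u v huv, h.2 u⟩⟩

/-! ### Finite-range precision: the origin row of `(G₀|_A)⁻¹` -/

variable (d) in
/-- **Row `0` of `(G₀|_A)⁻¹` is row `0` of `-Δ_A`** (`d ≥ 3`): if the finite set `A` contains `0` and its `2d`
neighbours `±eᵢ`, then for every `x ∈ A`, `((G₀|_A)⁻¹)(0,x) = (-Δ_A)(0,x)` (`= 2d` if `x = 0`, `-1` if `x ∼ 0`, `0`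
otherwise).  Proof: by `(-Δ)G₀ = δ₀` and locality of `Δ`, the row vector `(-Δ_A)(0,·)` times `G₀|_A` is `e₀`, and
`G₀|_A` is invertible.  This is the domain Markov property of the free field / the finite range of the precision
operator of the Green kernel, at the level of `Matrix.inv`. [cite: Lawler1991, §1.5] -/
theorem inv_halfGreen_origin_row (hd : 3 ≤ d) {A : Finset (Site d)} (h0 : (0 : Site d) ∈ A)
    (he : ∀ i : Fin d, (Pi.single i 1 : Site d) ∈ A ∧ (-Pi.single i 1 : Site d) ∈ A) (x : A) :
    (Matrix.of fun p q : A => latticeGreen (q.1 - p.1) / 2)⁻¹ ⟨0, h0⟩ x = dirichletMatrix A ⟨0, h0⟩ x := by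
  set V : Matrix A A ℝ := Matrix.of fun p q : A => latticeGreen (q.1 - p.1) / 2 with hV
  have hdet : IsUnit V.det := (Matrix.isUnit_iff_isUnit_det _).1 (posDef_halfGreen d hd A).isUnit
  -- the origin row of `-Δ_A` is a left inverse row: `(-Δ_A)(0,·) ᵥ* V = e₀`
  have hm : Matrix.vecMul (fun a : A => dirichletMatrix A ⟨0, h0⟩ a) V = Pi.single ⟨0, h0⟩ 1 := by
    funext q
    have hcol : Matrix.vecMul (fun a : A => dirichletMatrix A ⟨0, h0⟩ a) V q =
        (dirichletMatrix A *ᵥ fun a : A => latticeGreen (q.1 - a.1) / 2) ⟨0, h0⟩ := by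
      simp only [Matrix.vecMul, Matrix.mulVec, dotProduct, hV, Matrix.of_apply]
    rw [hcol, mulVec_dirichletMatrix]
    -- locality: the zero extension agrees with `z ↦ G₀(z - q)` at `0` and its neighbours
    have hloc : latticeLaplacianZd (zeroExtend A fun a : A => latticeGreen (q.1 - a.1) / 2) (0 : Site d) =
        latticeLaplacianZd (fun z : Site d => latticeGreen (z - q.1) / 2) 0 := by
      refine latticeLaplacianZd_congr ?_ (fun i => ?_) (fun i => ?_)
      · rw [zeroExtend_of_mem _ h0, latticeGreen_sub_comm]
      · rw [zero_add, zeroExtend_of_mem _ (he i).1, latticeGreen_sub_comm]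
      · rw [zero_sub, zeroExtend_of_mem _ (he i).2, latticeGreen_sub_comm]
    have h0' : ((⟨0, h0⟩ : A) : Site d) = 0 := rfl
    rw [h0', hloc, neg_latticeLaplacianZd_half_latticeGreen_sub d hd q.1 0, Pi.single_apply]
    by_cases hq : q = ⟨0, h0⟩
    · subst hq; simp
    · have hq' : (0 : Site d) ≠ q.1 := fun h => hq (Subtype.ext h.symm)
      simp [hq, hq']
  have hrow : (fun a : A => dirichletMatrix A ⟨0, h0⟩ a) = Matrix.vecMul (Pi.single ⟨0, h0⟩ 1) V⁻¹ := by
    rw [← hm, Matrix.vecMul_vecMul, Matrix.mul_nonsing_inv _ hdet, Matrix.vecMul_one]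
  have hx := congrFun hrow x
  rw [Matrix.single_one_vecMul] at hx
  simpa [Matrix.row] using hx.symm

variable (d) in
/-- In particular `((G₀|_A)⁻¹)(0,x) = 0` for `x ∈ A` neither `0` nor a neighbour of `0` (`A ⊇ {0, ±eᵢ}`, `d ≥ 3`):
the precision operator of the Green kernel has finite range. [cite: Lawler1991, §1.5] -/
theorem inv_halfGreen_origin_apply_eq_zero (hd : 3 ≤ d) {A : Finset (Site d)} (h0 : (0 : Site d) ∈ A)
    (he : ∀ i : Fin d, (Pi.single i 1 : Site d) ∈ A ∧ (-Pi.single i 1 : Site d) ∈ A) {x : Site d} (hx : x ∈ A)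
    (hx0 : x ≠ 0) (hxA : ¬ (zdGraph d).Adj 0 x) :
    (Matrix.of fun p q : A => latticeGreen (q.1 - p.1) / 2)⁻¹ ⟨0, h0⟩ ⟨x, hx⟩ = 0 := by
  rw [inv_halfGreen_origin_row d hd h0 he ⟨x, hx⟩]
  have h1 : (⟨0, h0⟩ : A) ≠ ⟨x, hx⟩ := fun h => hx0 (Subtype.ext_iff.mp h).symm
  simp only [dirichletMatrix, h1, if_false]
  exact if_neg hxA

end Literature.Probability.LatticeModels
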